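import Summits.Ventures.Crystal3D.Theorems.StickyWulffConstantNoReconstructionGainCapCount
import HarnessLib

/-!
# The contact deficiency of ANY finite packing in cap currency

HONEST FRAMING. Part of the venture `Summits/Ventures/Crystal3D` (cell `crystal3d-full`), helper
`--supports` the crux `NoReconstructionGain` (stmt-Ventures-19144, route
`route-Ventures-StickyWulffConstant`), line `adhesion` (wulff-p1 g10); the substrate-free case
`P = ∅` of the per-ball cap accounting (`…CapCount`), recorded because it is a closed formula for the
deficiency of an ARBITRARY finite unit packing that other lines of the route (free Wulff bound,
wall ledgers) can use:

* `contactDeficiency_eq_capSum` — for every finite unit packing `X`, every twelve-element set `U`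
  of unit vectors of `Λ₀` closed under negation (a bond star, in any fixed orientation) and every
  direction `ν`,
  `D(X) = Σ_{q ∈ X} ( #{vacant caps d of q, ⟪d,ν⟫ < 0} + ½ #{vacant caps d of q, ⟪d,ν⟫ = 0}
        − #{interstitial contacts of q strictly ν-below q} − ½ #{interstitial contacts ν-level} )`,
  i.e. DEFICIENCY = VACANT REGISTERED DOWN-SLOTS − INTERSTITIAL DOWN-BONDS, exactly (a cap of `q`
  about `d` is `{y : ⟪y − q, d⟫ > √3/2}`; it is vacant when no contact of `q` lies in it; a contact
  is interstitial when it lies in no cap).  For `ν` in general position the level terms vanish.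

Sanity: a single ball has `6` vacant down-caps and deficiency `6`; an exact lattice cluster has no
interstitial bonds and its deficiency is its number of vacant down-slots (the run count of the line
argument); an hcp pair of layers pays one vacant registered down-slot per twin-type bond.

WHAT THIS IS NOT: an inequality — it is an identity, so by itself it bounds nothing; rung F-C1 not
moved.
-/

noncomputable section

namespace Summit.Ventures.Crystal3D.Theorems

open Summit.Ventures.Crystal3D Finset
open Literature.MathematicalPhysics.StatisticalMechanics (fccStacking orderedContacts contactDeficiency)
open scoped InnerProductSpace

/-- **Deficiency in cap currency** (see the module docstring). -/
theorem contactDeficiency_eq_capSum (X : Finset (EuclideanSpace ℝ (Fin 3)))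
    (hX : ∀ p ∈ X, ∀ q ∈ X, p ≠ q → 1 ≤ dist p q)
    (U : Finset (EuclideanSpace ℝ (Fin 3)))
    (hU : ∀ d ∈ U, d ∈ fccStacking 1 (Real.sqrt (2 / 3)) ∧ ‖d‖ = 1) (hUneg : ∀ d ∈ U, -d ∈ U)
    (hUcard : U.card = 12) (ν : EuclideanSpace ℝ (Fin 3)) :
    contactDeficiency X = ∑ q ∈ X,
      (((U.filter fun d => ⟪d, ν⟫_ℝ < 0 ∧ ∀ x ∈ X, dist q x = 1 → ⟪x - q, d⟫_ℝ ≤ Real.sqrt 3 / 2).card : ℝ)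
        + (1 / 2) * ((U.filter fun d => ⟪d, ν⟫_ℝ = 0 ∧
            ∀ x ∈ X, dist q x = 1 → ⟪x - q, d⟫_ℝ ≤ Real.sqrt 3 / 2).card : ℝ)
        - ((X.filter fun x => dist q x = 1 ∧ (∀ d ∈ U, ⟪x - q, d⟫_ℝ ≤ Real.sqrt 3 / 2) ∧
            ⟪x, ν⟫_ℝ < ⟪q, ν⟫_ℝ).card : ℝ)
        - (1 / 2) * ((X.filter fun x => dist q x = 1 ∧ (∀ d ∈ U, ⟪x - q, d⟫_ℝ ≤ Real.sqrt 3 / 2) ∧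
            ⟪x, ν⟫_ℝ = ⟪q, ν⟫_ℝ).card : ℝ)) := by
  classical
  set c : ℝ := Real.sqrt 3 / 2 with hc
  set g : EuclideanSpace ℝ (Fin 3) → EuclideanSpace ℝ (Fin 3) → ℤ := fun x y =>
    (if ∃ d ∈ U, ⟪d, ν⟫_ℝ < 0 ∧ c < ⟪x - y, d⟫_ℝ then (1 : ℤ) else 0)
      + (if (∀ d ∈ U, ⟪x - y, d⟫_ℝ ≤ c) ∧ ⟪x, ν⟫_ℝ < ⟪y, ν⟫_ℝ then (1 : ℤ) else 0) with hg
  set t : EuclideanSpace ℝ (Fin 3) → EuclideanSpace ℝ (Fin 3) → ℤ := fun x y => g x y - g y x with ht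
  have ht_anti : ∀ x y, t x y = -t y x := fun x y => by simp only [ht]; ring
  set dF : EuclideanSpace ℝ (Fin 3) → ℝ := fun q => ((X.filter fun x => dist q x = 1).card : ℝ) with hdF
  set S : EuclideanSpace ℝ (Fin 3) → ℝ := fun q =>
    ((∑ x ∈ X.filter (fun x => dist q x = 1), t x q : ℤ) : ℝ) with hS
  set f : EuclideanSpace ℝ (Fin 3) → ℝ := fun q =>
    ((U.filter fun d => ⟪d, ν⟫_ℝ < 0 ∧ ∀ x ∈ X, dist q x = 1 → ⟪x - q, d⟫_ℝ ≤ c).card : ℝ)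
      + (1 / 2) * ((U.filter fun d => ⟪d, ν⟫_ℝ = 0 ∧ ∀ x ∈ X, dist q x = 1 → ⟪x - q, d⟫_ℝ ≤ c).card : ℝ)
      - ((X.filter fun x => dist q x = 1 ∧ (∀ d ∈ U, ⟪x - q, d⟫_ℝ ≤ c) ∧ ⟪x, ν⟫_ℝ < ⟪q, ν⟫_ℝ).card : ℝ)
      - (1 / 2) * ((X.filter fun x => dist q x = 1 ∧ (∀ d ∈ U, ⟪x - q, d⟫_ℝ ≤ c) ∧
          ⟪x, ν⟫_ℝ = ⟪q, ν⟫_ℝ).card : ℝ) with hf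
  -- per ball: the accounting with empty substrate
  have hkey : ∀ q ∈ X, dF q + S q = 12 - 2 * f q := by
    intro q hq
    have hq' : q ∈ X \ (∅ : Finset (EuclideanSpace ℝ (Fin 3))) := by rwa [sdiff_empty]
    have hK := perBall_capAccount_eq X ∅ hX (empty_subset X) U hU hUneg hUcard ν q hq'
    simp only [sdiff_empty, filter_empty, card_empty, Nat.cast_zero, mul_zero, add_zero, zero_add, notMem_empty,
      false_and, exists_false, and_false] at hK
    have h0 : (U.filter fun _ => False).card = 0 := by rw [card_eq_zero, filter_eq_empty_iff]; exact fun _ _ h => h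
    rw [h0] at hK
    simp only [Nat.cast_zero, mul_zero, add_zero] at hK
    set T := ∑ x ∈ X.filter (fun x => dist q x = 1), t x q with hT
    rw [← hc] at hK
    have hK' := congrArg (fun z : ℤ => (z : ℝ)) hK
    simp only [hdF, hS, hf, ← hT]
    push_cast at hK' ⊢
    linarith
  have hs0 : ∑ q ∈ X, S q = 0 := by
    simp only [hS]
    rw [← Int.cast_sum, sum_sum_transfer_eq_zero X t ht_anti, Int.cast_zero]
  have hord : (orderedContacts X : ℝ) = ∑ q ∈ X, dF q := orderedContacts_eq_sum_card_partners X
  have hdef : contactDeficiency X = 6 * (X.card : ℝ) - (orderedContacts X : ℝ) / 2 := rfl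
  have hsum : ∑ q ∈ X, (dF q + S q) = ∑ q ∈ X, (12 - 2 * f q) := sum_congr rfl hkey
  simp only [sum_add_distrib, sum_sub_distrib, sum_const, nsmul_eq_mul, ← mul_sum] at hsum
  have hfsum : ∑ q ∈ X, f q = ∑ q ∈ X,
      (((U.filter fun d => ⟪d, ν⟫_ℝ < 0 ∧ ∀ x ∈ X, dist q x = 1 → ⟪x - q, d⟫_ℝ ≤ Real.sqrt 3 / 2).card : ℝ)
        + (1 / 2) * ((U.filter fun d => ⟪d, ν⟫_ℝ = 0 ∧
            ∀ x ∈ X, dist q x = 1 → ⟪x - q, d⟫_ℝ ≤ Real.sqrt 3 / 2).card : ℝ)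
        - ((X.filter fun x => dist q x = 1 ∧ (∀ d ∈ U, ⟪x - q, d⟫_ℝ ≤ Real.sqrt 3 / 2) ∧
            ⟪x, ν⟫_ℝ < ⟪q, ν⟫_ℝ).card : ℝ)
        - (1 / 2) * ((X.filter fun x => dist q x = 1 ∧ (∀ d ∈ U, ⟪x - q, d⟫_ℝ ≤ Real.sqrt 3 / 2) ∧
            ⟪x, ν⟫_ℝ = ⟪q, ν⟫_ℝ).card : ℝ)) := rfl
  rw [← hfsum, hdef, hord]
  linarith

end Summit.Ventures.Crystal3D.Theorems

end
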